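import Summits.BirchSwinnertonDyer.BirchSwinnertonDyer.Theorems.ResidualThetaTransportAtTwoAwayDefs
import Summits.BirchSwinnertonDyer.BirchSwinnertonDyer.Theorems.ResidualThetaTransportAtTwoResidualSignedLambdaLowerCMAtTwoRhoLayerPairingGlueAwayTwo
import Summits.BirchSwinnertonDyer.BirchSwinnertonDyer.Theorems.ResidualThetaTransportAtTwoResidualSignedLambdaLowerCMAtTwoCofreeSelmerTransferKummer
import Summits.BirchSwinnertonDyer.BirchSwinnertonDyer.Theorems.ResidualThetaTransportAtTwoResidualSignedLambdaLowerCMAtTwoPlusPair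
import Literature.NumberTheory.EllipticCurves.IwasawaTowerTorsionOrdinaryProofs
import Literature.NumberTheory.GaloisRepresentations.DecompositionGroupOfCompletion
import Literature.NumberTheory.GaloisRepresentations.RatPlaceTwoProofs
import Literature.NumberTheory.EllipticCurves.H1CorestrictionIndexTwo
import HarnessLib

/-!
# T1 (AtTwo package), part 3: the PLUS condition `E⁺ ≤ D₂`, the Selmer dictionary `s ∈ Sg ↔ (s ∈ SelRel ∧ loc₂ s ∈ E⁺)`, and the Coleman
# kernel reading `c₂ t|_{E⁺} = 0 ⟹ colⁿ t = 0`

Route `ResidualThetaTransportAtTwo` (RTT), crux RSL_g `ResidualSignedLambdaLowerCMAtTwo` (stmt-BirchSwinnertonDyer-22608), line «onepair», GLUE-SPEC-g18 §1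
T1 (d)(e); seat `prover-bsd-wall-tp2-p2x-w2` g20 (`--supports`, closes nothing). THEOREMS ONLY (no definition, no named fact, no instance, no `sorry`;
`E⁺` is delivered as an EXISTENTIAL `AddSubgroup`). BSD is not proved by any of this; RSL_g (22608) stays OPEN.

* §0 `eq_of_two_mem_asIdeal` (one place of `ℚ` above `2`), `exists_resGalOfEmb_inv_mul_mem_kerSubgroup` (`Γ_ℚ = res(Γ_{ℚ_v}) · Γ_∞`: `2` is totally
  ramified in the cyclotomic `ℤ₂`-tower), `pow_dvd_of_nsmul_inv_pow_eq_zero` (`m • 2^{-k} = 0` in `ℚ/ℤ` forces `2^k ∣ m`).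
* §1 **`exists_localKummerData_jAway_thetaLayerKummer`** — the local class `j_{m,k}(Θ-Kummer class of a tuple of LAYER points Q₀)` has the explicit local
  Kummer datum `(R, k)`, `2^k R = Q₀` (chosen roots; `subgroupKummerCocycle`, `sum_thetaSingle`).
* §2 **`exists_Eplus`** — for the habitat objects at `v ∋ 2` (transport family `Θ`, `Sg` with its membership predicate `plusSelmerSet`, a local value
  character `c₂` with its VALUE PIN, the plus Coleman map `col` with its KERNEL PIN) there is `E⁺ ≤ D₂` (local classes with a PLUS Θ-Kummer datum) with
  (hSg) `s ∈ Sg ↔ s ∈ selRelSubgroup ∧ loc₂ s ∈ E⁺` (→: the `σ = 1` datum pulled back, `locKer_oneCocycleClass`; ←: `σ = θ(d)·u`, `u ∈ Γ_∞` acts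
  trivially, the datum of `loc₂ s` corrected by the coboundary `∂a` and conjugated by `d`, `E⁺(ℚ_{n,v})` being `Γ_{ℚ_v}`-stable) and
  (hπker) `(∀ e ∈ E⁺, c₂ t e = 0) → ∀ i, col (t ∘ single i) = 0` (evaluate on the classes of §1 for single plus points at every level `k`;
  `PadicInt.ext_of_toZModPow`).

References: [Kobayashi2003] Def. 1.1, Thm. 6.2, (8.23) (p. 18); [GreenbergVatsal2000] §2; [Washington1997] §13.1; [SilvermanAEC2009] VIII §2;
[SerreLocalFields1979] VII §5 Prop. 3.
-/

set_option autoImplicit false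
-- the Theorems namespace of this sub repeats the summit name by design (D-0017 nested layout)
set_option linter.dupNamespace false

noncomputable section

open scoped Classical

namespace Summit.BirchSwinnertonDyer.BirchSwinnertonDyer.Theorems.ThetaTransport.AtTwoPackage

open CategoryTheory Field NumberField IsDedekindDomain WeierstrassCurve
  Literature.NumberTheory.EllipticCurves Literature.NumberTheory.GaloisRepresentations
  Literature.NumberTheory.EllipticCurves.GreenbergSelmer Literature.NumberTheory.EllipticCurves.CyclotomicLayer
  Literature.NumberTheory.EllipticCurves.Kobayashi2003 Literature.NumberTheory.EllipticCurves.Sprung2012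
  Literature.NumberTheory.EllipticCurves.GreenbergVatsal2000
  Summit.BirchSwinnertonDyer.BirchSwinnertonDyer.Theorems.OnePair

/-! ## §0 One place above `2`; `Γ_ℚ = res(Γ_{ℚ_v}) · Γ_∞`; torsion of `ℚ/ℤ` -/

/-- `ℚ` has ONE place above `2`. [cite: Washington1997, §13.1] -/
theorem eq_of_two_mem_asIdeal {v v' : HeightOneSpectrum (𝓞 ℚ)} (hv : ((2 : ℕ) : 𝓞 ℚ) ∈ v.asIdeal)
    (hv' : ((2 : ℕ) : 𝓞 ℚ) ∈ v'.asIdeal) : v' = v := by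
  have h : Rat.HeightOneSpectrum.natGenerator v' = Rat.HeightOneSpectrum.natGenerator v := by
    rw [Rat.natGenerator_eq_of_prime_mem v Nat.prime_two hv, Rat.natGenerator_eq_of_prime_mem v' Nat.prime_two hv']
  exact Rat.HeightOneSpectrum.primesEquiv.injective (Subtype.ext h)

/-- **`Γ_ℚ = res(Γ_{ℚ_v}) · Gal(ℚ̄/ℚ_∞)` at `v ∋ 2`** for the cyclotomic `ℤ₂`-extension (`2` totally ramified in `ℚ_∞`: `Γ_ℚ = I_{𝔓₀} · ker κ`,
`I_{𝔓₀} ≤ D_{𝔓₀} = res(Γ_{ℚ_v})`). [cite: Washington1997, §13.1] [cite: NeukirchANT1999, Ch. II §9 Prop. (9.6)] -/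
theorem exists_resGalOfEmb_inv_mul_mem_kerSubgroup (κ : ZpExtension ℚ 2) (hκ : κ.IsCyclotomic) {v : HeightOneSpectrum (𝓞 ℚ)}
    (hv : ((2 : ℕ) : 𝓞 ℚ) ∈ v.asIdeal) (σ : absoluteGaloisGroup ℚ) :
    ∃ d : absoluteGaloisGroup (v.adicCompletion ℚ), (resGalOfEmb (closureEmb (K := ℚ) (v.adicCompletion ℚ)) d)⁻¹ * σ ∈ κ.kerSubgroup := by
  have hv2 : (Rat.HeightOneSpectrum.primesEquiv v : ℕ) = 2 := Rat.natGenerator_eq_of_prime_mem v Nat.prime_two hv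
  obtain ⟨τ, hτ, hk⟩ := hκ.exists_mem_inertia_inv_mul_mem_kerSubgroup hv2 (adicCompletionPrime_mem_primesAbove ℚ v) σ
  have hτD := Ideal.inertia_le_decompositionSubgroup (absoluteGaloisGroup ℚ) _ hτ
  rw [decompositionSubgroup_adicCompletionPrime_eq_range] at hτD
  obtain ⟨d, rfl⟩ := hτD
  exact ⟨d, hk⟩

/-- `m • 2^{-k} = 0` in `ℚ/ℤ` forces `2^k ∣ m` (`2^{-k}` has additive order `2^k`). [folklore] -/
theorem pow_dvd_of_nsmul_inv_pow_eq_zero {k m : ℕ} (h : m • ((((2 : ℚ) ^ k)⁻¹ : ℚ) : AddCircle (1 : ℚ)) = 0) : 2 ^ k ∣ m := by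
  have hpos : 0 < 2 ^ k := pow_pos two_pos k
  have ho := AddCircle.addOrderOf_div_of_gcd_eq_one (p := (1 : ℚ)) (m := 1) hpos (Nat.gcd_one_left _)
  have ho' : addOrderOf ((((2 : ℚ) ^ k)⁻¹ : ℚ) : AddCircle (1 : ℚ)) = 2 ^ k := by simpa [one_div] using ho
  rw [← ho']
  exact addOrderOf_dvd_of_nsmul_eq_zero h

/-! ## §1 The local Kummer datum of `j_{m,k}(Θ-Kummer class of layer points)` -/

section LayerKummer

variable (S : Set (PadicAlgCl 2)) (ρ : FramedGaloisRep ℚ ↥(padicCoeffIntegers S) 2)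
  (W : WeierstrassCurve ℚ) [W.IsElliptic] {r : ℕ} (Θ : Cofree ρ ↥(padicCoeffField S) ≃+ (Fin r → ↥(W.geomPrimaryTorsion 2)))
  (κ : ZpExtension ℚ 2) (v : HeightOneSpectrum (𝓞 ℚ))
  (hΘ : ∀ (δ : absoluteGaloisGroup (v.adicCompletion ℚ)) (m : Cofree ρ ↥(padicCoeffField S)) (i : Fin r),
    Θ (resGalOfEmb (closureEmb (K := ℚ) (v.adicCompletion ℚ)) δ • m) i =
      resGalOfEmb (closureEmb (K := ℚ) (v.adicCompletion ℚ)) δ • Θ m i)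

-- the coercion towers `A_ρ[2^k] ↪ A_ρ →Θ E[2^∞]^r ↪ E(ℚ̄)^r → E(ℚ̄_v)^r` (as in `…CofreeSelmerTransferKummer` §1)
set_option maxHeartbeats 1600000 in
/-- **The local Kummer datum of a Θ-Kummer class of layer points.** For `Q₀ ∈ E(ℚ_{m,v})^r` the local class
`j_{m,k}(thetaLayerKummer … m Q₀) ∈ D₂` is represented by a cocycle `ψ` of `U_{∞,v}` with `ι(Θ(ψ τ)_i) = τ R_i − R_i`, `2^k R_i = Q₀ i` (chosen roots;
`thetaLayerKummer Q₀ = [Σ_i (thetaSingle i)_* κ(Q'_i)]`, `sum_thetaSingle`, `pointsMap_subgroupKummerCocycle_apply`). [cite: Kobayashi2003, §2 (p. 4), (8.23) (p. 18)]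
[cite: SilvermanAEC2009, VIII §2] -/
theorem exists_localKummerData_jAway_thetaLayerKummer (m k : ℕ)
    (Q₀ : Fin r → ↥(localLayerPointsOfEmb κ (closureEmb (K := ℚ) (v.adicCompletion ℚ)) W m)) :
    ∃ (ψ : contOneCocycles (subgroupRep (localRepOf (cofreeGaloisModule S ρ) v) (kerGroup κ v)))
      (R : Fin r → localPoints W (v.adicCompletion ℚ)),
      oneCocycleClass _ ψ = jAway S κ ρ v m k (thetaLayerKummer S ρ k W Θ κ v hΘ m Q₀) ∧
      (∀ i, (2 ^ k) • R i = (Q₀ i : localPoints W (v.adicCompletion ℚ))) ∧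
      ∀ (τ : ↥(kerGroup κ v)) (i : Fin r), pointsMapOfEmb W (closureEmb (K := ℚ) (v.adicCompletion ℚ))
        ((Θ (ψ.1 τ) i : ↥(W.geomPrimaryTorsion 2)) : W.geomPoints) = (τ : absoluteGaloisGroup (v.adicCompletion ℚ)) • R i - R i := by
  have hN : ((2 ^ k : ℕ) : ℤ) ≠ 0 := by exact_mod_cast pow_ne_zero k two_ne_zero
  -- roots and their Kummer cocycles on `U_m`
  obtain ⟨Q', hR⟩ : ∃ Q' : Fin r → localPoints W (v.adicCompletion ℚ),
      ∀ i, ((2 ^ k : ℕ) : ℤ) • Q' i = (Q₀ i : localPoints W (v.adicCompletion ℚ)) :=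
    ⟨fun i ↦ W.subgroupZSMulRoot ((2 ^ k : ℕ) : ℤ) hN (Q₀ i : localPoints W (v.adicCompletion ℚ)), fun i ↦ W.zsmul_subgroupZSMulRoot _ hN _⟩
  have hfix : ∀ i, ((2 ^ k : ℕ) : ℤ) • Q' i ∈ FixedPoints.addSubgroup (layerGroup κ v m) (localPoints W (v.adicCompletion ℚ)) := fun i ↦ by
    rw [hR]; exact (Q₀ i).2
  have hK : ∀ i, layerKummer W (2 ^ k) κ v m (Q₀ i) =
      oneCocycleClass _ (W.subgroupKummerCocycle ((2 ^ k : ℕ) : ℤ) (layerGroup κ v m) hN (Q' i) (hfix i)) := fun i ↦ by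
    change W.subgroupKummerMap ((2 ^ k : ℕ) : ℤ) (layerGroup κ v m) hN (Q₀ i) = _
    rw [W.subgroupKummerMap_apply_eq _ _ hN (Q₀ i) (Q' i) (hfix i) (hR i)]
    rfl
  -- the Θ-Kummer class as ONE explicit cocycle `β` of `U_m`
  set β : contOneCocycles (subgroupRep (cofreeTorsionLocalRep S ρ ((2 ^ k : ℕ) : ℤ) v) (layerGroup κ v m)) :=
    ∑ i, contOneCocycles.pushAddHom (thetaSingle ρ 2 k W Θ i) continuous_of_discreteTopology
      (thetaSingle_subgroupRep S ρ k W Θ κ v hΘ i m) (W.subgroupKummerCocycle ((2 ^ k : ℕ) : ℤ) (layerGroup κ v m) hN (Q' i) (hfix i)) with hβ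
  have hT : thetaLayerKummer S ρ k W Θ κ v hΘ m Q₀ = oneCocycleClass _ β := by
    rw [thetaLayerKummer_apply, hβ, ← oneCocycleClassₗ_apply, map_sum]
    refine Finset.sum_congr rfl fun i _ ↦ ?_
    rw [oneCocycleClassₗ_apply, hK i, thetaSingleH1_oneCocycleClass]
  -- values of `β`, read through `Θ`, coordinate `i`, then `ι`
  have hβval : ∀ (τ : ↥(layerGroup κ v m)) (i : Fin r), pointsMapOfEmb W (closureEmb (K := ℚ) (v.adicCompletion ℚ))
      ((Θ ((β.1 τ : ↥(AddSubgroup.torsionBy (Cofree ρ ↥(padicCoeffField S)) ((2 ^ k : ℕ) : ℤ))) : Cofree ρ ↥(padicCoeffField S)) i :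
        ↥(W.geomPrimaryTorsion 2)) : W.geomPoints) = (τ : absoluteGaloisGroup (v.adicCompletion ℚ)) • Q' i - Q' i := by
    intro τ i
    have e1 : (β.1 τ : ↥(AddSubgroup.torsionBy (Cofree ρ ↥(padicCoeffField S)) ((2 ^ k : ℕ) : ℤ))) =
        ∑ j, thetaSingle ρ 2 k W Θ j ((W.subgroupKummerCocycle ((2 ^ k : ℕ) : ℤ) (layerGroup κ v m) hN (Q' j) (hfix j)).1 τ) := by
      rw [hβ, Submodule.coe_sum, ContinuousMap.sum_apply]
      rfl
    rw [e1, AddSubmonoidClass.coe_finsetSum, sum_thetaSingle, AddEquiv.apply_symm_apply]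
    exact W.pointsMap_subgroupKummerCocycle_apply _ _ hN (Q' i) (hfix i) τ
  -- push to `A_ρ` and restrict to `U_∞`: the cocycle of `jAway [β]`
  obtain ⟨ψ, hψ, hψval⟩ : ∃ ψ : contOneCocycles (subgroupRep (localRepOf (cofreeGaloisModule S ρ) v) (kerGroup κ v)),
      oneCocycleClass _ ψ = jAway S κ ρ v m k (thetaLayerKummer S ρ k W Θ κ v hΘ m Q₀) ∧
      ∀ τ : ↥(kerGroup κ v), (ψ.1 τ : Cofree ρ ↥(padicCoeffField S)) =
        ((β.1 ⟨(τ : absoluteGaloisGroup (v.adicCompletion ℚ)), kerGroup_le_layerGroup κ v m τ.2⟩ :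
          ↥(AddSubgroup.torsionBy (Cofree ρ ↥(padicCoeffField S)) ((2 ^ k : ℕ) : ℤ))) : Cofree ρ ↥(padicCoeffField S)) := by
    rw [hT, jAway_apply, resLe_oneCocycleClass, cohomologyMap_oneCocycleClass]
    exact ⟨_, rfl, fun τ ↦ rfl⟩
  refine ⟨ψ, Q', hψ, fun i ↦ ?_, fun τ i ↦ ?_⟩
  · rw [← natCast_zsmul]; exact hR i
  · rw [hψval τ]
    exact hβval ⟨(τ : absoluteGaloisGroup (v.adicCompletion ℚ)), kerGroup_le_layerGroup κ v m τ.2⟩ i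

end LayerKummer

/-! ## §2 `E⁺`, the Selmer dictionary, and the Coleman kernel reading -/

section Plus

variable (S : Set (PadicAlgCl 2)) (ρ : FramedGaloisRep ℚ ↥(padicCoeffIntegers S) 2)
  (W : WeierstrassCurve ℚ) [W.IsElliptic] (κ : ZpExtension ℚ 2) (S₀ : Finset (HeightOneSpectrum (𝓞 ℚ))) {r : ℕ}
  (Θ : ∀ v : HeightOneSpectrum (𝓞 ℚ), ((2 : ℕ) : 𝓞 ℚ) ∈ v.asIdeal → (Cofree ρ ↥(padicCoeffField S) ≃+ (Fin r → ↥(W.geomPrimaryTorsion 2))))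
  (hΘ : ∀ v hv (δ : absoluteGaloisGroup (v.adicCompletion ℚ)) m i,
    Θ v hv (resGalOfEmb (closureEmb (K := ℚ) (v.adicCompletion ℚ)) δ • m) i = resGalOfEmb (closureEmb (K := ℚ) (v.adicCompletion ℚ)) δ • Θ v hv m i)
  (v : HeightOneSpectrum (𝓞 ℚ)) (hv : ((2 : ℕ) : 𝓞 ℚ) ∈ v.asIdeal)

-- coercion towers as in §1; the Selmer predicate `plusSelmerSet` is a large set-builder
set_option maxHeartbeats 2400000 in
include hΘ in
/-- **T1 (d)(e): the PLUS condition `E⁺ ≤ D₂`, the Selmer dictionary, and the Coleman kernel reading.** On the habitat (`κ` cyclotomic, `v ∋ 2`), for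
`Sg ≤ H¹(Γ_∞, A_ρ)` with membership predicate `plusSelmerSet` (`hmem`), ANY additive `c₂ : 𝔉₂ →+ CharacterModule D₂` carrying the VALUE PIN on local
Θ-Kummer data (`hc₂` = `AtTwoPins.hc₂`), and ANY `col` carrying the KERNEL PIN of the plus Coleman map (`hcol` = `OnePairPins.hcol_ker`), there is an additive
subgroup `E⁺ ≤ D₂` — the local classes admitting a PLUS Θ-Kummer datum (`2^k Q_i ∈ ⨆_n E⁺(ℚ_{n,v})`) — such that
(hSg) `s ∈ Sg ↔ s ∈ selRelSubgroup ∧ loc₂ s ∈ E⁺` and (hπker) `(∀ e ∈ E⁺, c₂ t e = 0) → ∀ i, col (t ∘ single i) = 0`.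
[cite: Kobayashi2003, Def. 1.1, Thm. 6.2, (8.23) (p. 18)] [cite: GreenbergVatsal2000, §2] [cite: SerreLocalFields1979, VII §5 Prop. 3] -/
theorem exists_Eplus (hκ : κ.IsCyclotomic)
    (Sg : AddSubgroup (subgroupH1 κ.kerSubgroup (Cofree ρ ↥(padicCoeffField S))))
    (hmem : ∀ y : subgroupH1 κ.kerSubgroup (Cofree ρ ↥(padicCoeffField S)), y ∈ Sg ↔ y ∈ plusSelmerSet S W κ S₀ r ρ Θ)
    (c₂ : ((Fin r → ↥(localTowerPointsOfEmb κ (closureEmb (K := ℚ) (v.adicCompletion ℚ)) W)) →+ ℤ_[2]) →+ CharacterModule (Dloc S κ ρ v))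
    (hc₂ : ∀ (t : (Fin r → ↥(localTowerPointsOfEmb κ (closureEmb (K := ℚ) (v.adicCompletion ℚ)) W)) →+ ℤ_[2])
      (y : Dloc S κ ρ v) (ψ : contOneCocycles (subgroupRep (localRepOf (cofreeGaloisModule S ρ) v) (kerGroup κ v)))
      (Q : Fin r → localPoints W (v.adicCompletion ℚ)) (k : ℕ)
      (hQ : ∀ i, (2 ^ k) • Q i ∈ localTowerPointsOfEmb κ (closureEmb (K := ℚ) (v.adicCompletion ℚ)) W),
      oneCocycleClass (subgroupRep (localRepOf (cofreeGaloisModule S ρ) v) (kerGroup κ v)) ψ = y →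
      (∀ (τ : ↥(kerGroup κ v)) (i : Fin r), pointsMapOfEmb W (closureEmb (K := ℚ) (v.adicCompletion ℚ))
        ((Θ v hv (ψ.1 τ) i : ↥(W.geomPrimaryTorsion 2)) : W.geomPoints) = (τ : absoluteGaloisGroup (v.adicCompletion ℚ)) • Q i - Q i) →
      c₂ t y = (PadicInt.toZModPow k (t (fun i => ⟨(2 ^ k) • Q i, hQ i⟩))).val • ((((2 : ℚ) ^ k)⁻¹ : ℚ) : AddCircle (1 : ℚ)))
    (col : (↥(localTowerPointsOfEmb κ (closureEmb (K := ℚ) (v.adicCompletion ℚ)) W) →+ ℤ_[2]) →ₗ[ℤ_[2]] PowerSeries ℤ_[2])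
    (hcol : ∀ z : ↥(localTowerPointsOfEmb κ (closureEmb (K := ℚ) (v.adicCompletion ℚ)) W) →+ ℤ_[2],
      col z = 0 ↔ ∀ (m : ℕ) (x : localPoints W (v.adicCompletion ℚ)) (hx : x ∈ signedLocalPoints κ (v.adicCompletion ℚ) W 1 m),
        z ⟨x, localLayerPointsOfEmb_le_localTowerPointsOfEmb κ (closureEmb (K := ℚ) (v.adicCompletion ℚ)) W m
          (signedLocalPointsOfEmb_le κ (closureEmb (K := ℚ) (v.adicCompletion ℚ)) W 1 m hx)⟩ = 0) :
    ∃ Eplus : AddSubgroup (Dloc S κ ρ v),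
      (∀ s : subgroupH1 κ.kerSubgroup (Cofree ρ ↥(padicCoeffField S)), s ∈ Sg ↔ s ∈ selRelSubgroup S κ ρ S₀ ∧ locKer S κ ρ v s ∈ Eplus) ∧
      ∀ t : (Fin r → ↥(localTowerPointsOfEmb κ (closureEmb (K := ℚ) (v.adicCompletion ℚ)) W)) →+ ℤ_[2],
        (∀ e ∈ Eplus, c₂ t e = 0) →
        ∀ i : Fin r, col (t.comp (AddMonoidHom.single (fun _ : Fin r => ↥(localTowerPointsOfEmb κ (closureEmb (K := ℚ) (v.adicCompletion ℚ)) W)) i)) = 0 := by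
  -- the plus Kummer predicate on local cocycles
  let IsW : contOneCocycles (subgroupRep (localRepOf (cofreeGaloisModule S ρ) v) (kerGroup κ v)) →
      (Fin r → localPoints W (v.adicCompletion ℚ)) → Prop := fun ψ Q ↦
    ∀ (τ : ↥(kerGroup κ v)) (i : Fin r), pointsMapOfEmb W (closureEmb (K := ℚ) (v.adicCompletion ℚ))
      ((Θ v hv (ψ.1 τ) i : ↥(W.geomPrimaryTorsion 2)) : W.geomPoints) = (τ : absoluteGaloisGroup (v.adicCompletion ℚ)) • Q i - Q i
  let Pl : AddSubgroup (localPoints W (v.adicCompletion ℚ)) := ⨆ n : ℕ, signedLocalPoints κ (v.adicCompletion ℚ) W 1 n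
  have isW_add : ∀ {ψ ψ' Q Q'}, IsW ψ Q → IsW ψ' Q' → IsW (ψ + ψ') (Q + Q') := fun {ψ ψ' Q Q'} h h' τ i ↦ by
    have e : ((ψ + ψ').1 τ : Cofree ρ ↥(padicCoeffField S)) = ψ.1 τ + ψ'.1 τ := rfl
    change pointsMapOfEmb W _ ((Θ v hv ((ψ + ψ').1 τ) i : ↥(W.geomPrimaryTorsion 2)) : W.geomPoints) = _
    rw [e, map_add, Pi.add_apply, AddMemClass.coe_add, map_add, h τ i, h' τ i, Pi.add_apply, smul_add]
    abel
  have isW_neg : ∀ {ψ Q}, IsW ψ Q → IsW (-ψ) (-Q) := fun {ψ Q} h τ i ↦ by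
    have e : ((-ψ).1 τ : Cofree ρ ↥(padicCoeffField S)) = -ψ.1 τ := rfl
    change pointsMapOfEmb W _ ((Θ v hv ((-ψ).1 τ) i : ↥(W.geomPrimaryTorsion 2)) : W.geomPoints) = _
    rw [e, map_neg, Pi.neg_apply, NegMemClass.coe_neg, map_neg, h τ i, Pi.neg_apply, smul_neg]
    abel
  have isW_zero : IsW 0 0 := fun τ i ↦ by
    change pointsMapOfEmb W _ ((Θ v hv (0 : Cofree ρ ↥(padicCoeffField S)) i : ↥(W.geomPrimaryTorsion 2)) : W.geomPoints) = _
    rw [map_zero, Pi.zero_apply, ZeroMemClass.coe_zero, map_zero, Pi.zero_apply, smul_zero, sub_zero]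
  -- `E⁺`
  let Eplus : AddSubgroup (Dloc S κ ρ v) :=
    { carrier := {e | ∃ (ψ : contOneCocycles (subgroupRep (localRepOf (cofreeGaloisModule S ρ) v) (kerGroup κ v)))
        (Q : Fin r → localPoints W (v.adicCompletion ℚ)) (k : ℕ), oneCocycleClass _ ψ = e ∧ (∀ i, (2 ^ k) • Q i ∈ Pl) ∧ IsW ψ Q}
      zero_mem' := ⟨0, 0, 0, oneCocycleClass_zero _, fun i ↦ by rw [Pi.zero_apply, smul_zero]; exact zero_mem _, isW_zero⟩
      add_mem' := by
        rintro e e' ⟨ψ, Q, k, hψ, hQ, hW⟩ ⟨ψ', Q', k', hψ', hQ', hW'⟩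
        refine ⟨ψ + ψ', Q + Q', k + k', by rw [oneCocycleClass_add, hψ, hψ'], fun i ↦ ?_, isW_add hW hW'⟩
        rw [Pi.add_apply, smul_add]
        refine add_mem ?_ ?_
        · rw [pow_add, mul_comm, mul_smul]; exact AddSubgroup.nsmul_mem _ (hQ i) _
        · rw [pow_add, mul_smul]; exact AddSubgroup.nsmul_mem _ (hQ' i) _
      neg_mem' := by
        rintro e ⟨ψ, Q, k, hψ, hQ, hW⟩
        refine ⟨-ψ, -Q, k, ?_, fun i ↦ by rw [Pi.neg_apply, smul_neg]; exact neg_mem (hQ i), isW_neg hW⟩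
        rw [← oneCocycleClassₗ_apply, map_neg, oneCocycleClassₗ_apply, hψ] }
  refine ⟨Eplus, fun s ↦ ⟨fun hs ↦ ?_, fun hs ↦ ?_⟩, fun t ht i ↦ ?_⟩
  · -- (→): SelRel by the first two clauses; the `σ = 1` plus datum pulled back to `U_{∞,v}`
    obtain ⟨hunr, hinf, hplus⟩ := (hmem s).1 hs
    refine ⟨(mem_selRelSubgroup_iff S κ ρ S₀ s).2 ⟨hunr, hinf⟩, ?_⟩
    obtain ⟨φ, Q, k, hφ, hQ, hK⟩ := hplus v hv 1
    rw [Literature.NumberTheory.EllipticCurves.conjH1_one_holds κ.kerSubgroup (Cofree ρ ↥(padicCoeffField S)), AddMonoidHom.id_apply] at hφ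
    subst hφ
    change locKer S κ ρ v (oneCocycleClass _ φ) ∈ Eplus
    rw [locKer_oneCocycleClass]
    exact ⟨_, Q, k, rfl, hQ, fun τ i ↦ by rw [locKer_pullback_apply]; exact hK τ i⟩
  · -- (←): every place above `2` is `v`; `σ = θ(d) · u` with `u ∈ Γ_∞`; correct the local datum by a coboundary and conjugate by `d`
    obtain ⟨hsel, ψ, Q, k, hψ, hQ, hW⟩ := hs
    obtain ⟨hunr, hinf⟩ := (mem_selRelSubgroup_iff S κ ρ S₀ s).1 hsel
    refine (hmem s).2 ⟨hunr, hinf, fun v' hv' σ ↦ ?_⟩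
    have hvv : v = v' := (eq_of_two_mem_asIdeal hv hv').symm
    subst hvv
    -- a global cocycle of `s` and its local correction
    obtain ⟨φ, hφ⟩ := oneCocycleClass_surjective (discreteTopRep ↥κ.kerSubgroup (Cofree ρ ↥(padicCoeffField S))) s
    have hloc : oneCocycleClass (subgroupRep (localRepOf (cofreeGaloisModule S ρ) v) (kerGroup κ v))
        (contOneCocycles.pullback (resGalSubgroupOfEmb κ.kerSubgroup (closureEmb (K := ℚ) (v.adicCompletion ℚ)))
          (X := subgroupRep (cofreeGaloisModule S ρ).toTopRep κ.kerSubgroup) (Y := subgroupRep (localRepOf (cofreeGaloisModule S ρ) v) (kerGroup κ v))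
          (TopRep.ofHom ⟨ContinuousLinearMap.id ℤ (Cofree ρ ↥(padicCoeffField S)), fun _ ↦ rfl⟩) φ - ψ) = 0 := by
      rw [oneCocycleClass_sub, ← locKer_oneCocycleClass, hψ, sub_eq_zero]
      exact congrArg _ hφ
    obtain ⟨a, ha⟩ := (oneCocycleClass_eq_zero_iff _ _).mp hloc
    have ha' : ∀ τ : ↥(kerGroup κ v), (φ.1 (resGalSubgroupOfEmb κ.kerSubgroup (closureEmb (K := ℚ) (v.adicCompletion ℚ)) τ) : Cofree ρ ↥(padicCoeffField S)) =
        ψ.1 τ + (resGalOfEmb (closureEmb (K := ℚ) (v.adicCompletion ℚ)) (τ : absoluteGaloisGroup (v.adicCompletion ℚ)) • a - a) := fun τ ↦ by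
      have h := ha τ
      rw [← sub_eq_iff_eq_add']
      exact h
    obtain ⟨e, he⟩ := PlusValue.exists_pow_smul_theta_eq_zero W (Θ v hv) a
    -- the corrected global datum `(φ, Q + P, k + e)` of `s` itself, `P_i = ι(Θ a)_i`
    set P : Fin r → localPoints W (v.adicCompletion ℚ) := fun i ↦
      pointsMapOfEmb W (closureEmb (K := ℚ) (v.adicCompletion ℚ)) ((Θ v hv a i : ↥(W.geomPrimaryTorsion 2)) : W.geomPoints) with hP
    have hPe : ∀ i, (2 ^ e) • P i = 0 := fun i ↦ by rw [hP]; change (2 ^ e) • pointsMapOfEmb W _ _ = 0; rw [← map_nsmul, he i, map_zero]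
    have hQP : ∀ i, (2 ^ (k + e)) • (Q i + P i) ∈ Pl := fun i ↦ by
      rw [smul_add, pow_add, mul_smul, mul_smul, hPe i, smul_zero, add_zero, smul_comm]
      exact AddSubgroup.nsmul_mem _ (hQ i) _
    have hKφ : ∀ (τ : ↥(localSubgroupOfEmb κ.kerSubgroup (closureEmb (K := ℚ) (v.adicCompletion ℚ)))) (i : Fin r),
        pointsMapOfEmb W (closureEmb (K := ℚ) (v.adicCompletion ℚ))
          (((Θ v hv (φ.1 (resGalSubgroupOfEmb κ.kerSubgroup (closureEmb (K := ℚ) (v.adicCompletion ℚ)) τ))) i : ↥(W.geomPrimaryTorsion 2)) : W.geomPoints) =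
          (τ : absoluteGaloisGroup (v.adicCompletion ℚ)) • (Q i + P i) - (Q i + P i) := by
      intro τ i
      rw [ha' τ, map_add, Pi.add_apply, AddMemClass.coe_add, map_add, hW τ i, map_sub, Pi.sub_apply, AddSubgroupClass.coe_sub, map_sub, hΘ,
        primaryComponent.coe_smul, pointsMapOfEmb_smul, smul_add]
      change _ + ((τ : absoluteGaloisGroup (v.adicCompletion ℚ)) • P i - P i) = _
      abel
    -- `σ = θ(d) · u`, `u ∈ Γ_∞`
    obtain ⟨dd, hd⟩ := exists_resGalOfEmb_inv_mul_mem_kerSubgroup κ hκ hv σ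
    have hσ : conjH1 κ.kerSubgroup (Cofree ρ ↥(padicCoeffField S)) σ s =
        conjH1 κ.kerSubgroup (Cofree ρ ↥(padicCoeffField S)) (resGalOfEmb (closureEmb (K := ℚ) (v.adicCompletion ℚ)) dd) s := by
      conv_lhs => rw [show σ = resGalOfEmb (closureEmb (K := ℚ) (v.adicCompletion ℚ)) dd *
        ((resGalOfEmb (closureEmb (K := ℚ) (v.adicCompletion ℚ)) dd)⁻¹ * σ) by rw [mul_inv_cancel_left]]
      rw [Literature.NumberTheory.EllipticCurves.conjH1_mul_holds, AddMonoidHom.comp_apply,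
        Literature.NumberTheory.EllipticCurves.conjH1_of_mem_holds κ.kerSubgroup (Cofree ρ ↥(padicCoeffField S)) hd, AddMonoidHom.id_apply]
    refine ⟨conjCocycle κ.kerSubgroup (resGalOfEmb (closureEmb (K := ℚ) (v.adicCompletion ℚ)) dd) φ, fun i ↦ dd • (Q i + P i), k + e, ?_,
      fun i ↦ ?_, fun τ i ↦ ?_⟩
    · rw [hσ, ← hφ, conjH1_oneCocycleClass]
    · rw [smul_comm]
      obtain hmem' := hQP i
      -- `Pl` is `Γ_{ℚ_v}`-stable
      refine AddSubgroup.iSup_induction (C := fun x ↦ dd • x ∈ Pl) _ hmem' (fun n x hx ↦ ?_) ?_ (fun x y hx hy ↦ ?_)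
      · exact AddSubgroup.mem_iSup_of_mem n (SignedLowerOffTwo.PTDeep.smul_mem_signedLocalPointsOfEmb κ (closureEmb (K := ℚ) (v.adicCompletion ℚ)) W 1 n dd hx)
      · rw [smul_zero]; exact zero_mem _
      · rw [smul_add]; exact add_mem hx hy
    · -- the conjugated values
      have hτ' : dd⁻¹ * (τ : absoluteGaloisGroup (v.adicCompletion ℚ)) * dd ∈ kerGroup κ v := by
        rw [mem_localSubgroupOfEmb_iff, map_mul, map_mul, map_inv]
        exact κ.kerSubgroup_normal.conj_mem' _ ((mem_localSubgroupOfEmb_iff κ.kerSubgroup (closureEmb (K := ℚ) (v.adicCompletion ℚ)) _).1 τ.2) _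
      have hconj : subgroupConj κ.kerSubgroup (resGalOfEmb (closureEmb (K := ℚ) (v.adicCompletion ℚ)) dd)
          (resGalSubgroupOfEmb κ.kerSubgroup (closureEmb (K := ℚ) (v.adicCompletion ℚ)) τ) =
          resGalSubgroupOfEmb κ.kerSubgroup (closureEmb (K := ℚ) (v.adicCompletion ℚ)) ⟨dd⁻¹ * (τ : absoluteGaloisGroup (v.adicCompletion ℚ)) * dd, hτ'⟩ := by
        apply Subtype.ext
        rw [subgroupConj_apply_coe, resGalSubgroupOfEmb_apply_coe, resGalSubgroupOfEmb_apply_coe, map_mul, map_mul, map_inv]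
      rw [conjCocycle_apply, hconj, hΘ, primaryComponent.coe_smul, pointsMapOfEmb_smul, hKφ ⟨_, hτ'⟩, smul_sub, smul_smul, smul_smul]
      congr 1
      rw [show dd * (dd⁻¹ * (τ : absoluteGaloisGroup (v.adicCompletion ℚ)) * dd) = (τ : absoluteGaloisGroup (v.adicCompletion ℚ)) * dd by group, mul_smul]
  · -- (hπker): evaluate on the local Kummer classes of single plus points at every level `k`
    refine (hcol _).2 fun m x hx ↦ ?_
    have hxm : x ∈ localLayerPointsOfEmb κ (closureEmb (K := ℚ) (v.adicCompletion ℚ)) W m :=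
      signedLocalPointsOfEmb_le κ (closureEmb (K := ℚ) (v.adicCompletion ℚ)) W 1 m hx
    have hxT : x ∈ localTowerPointsOfEmb κ (closureEmb (K := ℚ) (v.adicCompletion ℚ)) W := localLayerPointsOfEmb_le_localTowerPointsOfEmb κ _ W m hxm
    rw [AddMonoidHom.comp_apply, AddMonoidHom.single_apply]
    -- `t (single i x) ≡ 0 mod 2^k` for every `k`
    set x₀ : ↥(localLayerPointsOfEmb κ (closureEmb (K := ℚ) (v.adicCompletion ℚ)) W m) := ⟨x, hxm⟩ with hx₀
    set x₁ : ↥(localTowerPointsOfEmb κ (closureEmb (K := ℚ) (v.adicCompletion ℚ)) W) := ⟨x, hxT⟩ with hx₁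
    refine PadicInt.ext_of_toZModPow.mp fun k ↦ ?_
    rw [map_zero]
    obtain ⟨ψ, R, hψ, hR, hK⟩ := exists_localKummerData_jAway_thetaLayerKummer S ρ W (Θ v hv) κ v (hΘ v hv) m k (Pi.single i x₀ : Fin r → ↥(localLayerPointsOfEmb κ (closureEmb (K := ℚ) (v.adicCompletion ℚ)) W m))
    have hRT : ∀ j, (2 ^ k) • R j ∈ localTowerPointsOfEmb κ (closureEmb (K := ℚ) (v.adicCompletion ℚ)) W := fun j ↦ by
      rw [hR j]; exact localLayerPointsOfEmb_le_localTowerPointsOfEmb κ _ W m ((Pi.single i x₀ : Fin r → ↥(localLayerPointsOfEmb κ (closureEmb (K := ℚ) (v.adicCompletion ℚ)) W m)) j).2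
    have hRpl : ∀ j, (2 ^ k) • R j ∈ Pl := fun j ↦ by
      rw [hR j]
      by_cases hj : j = i
      · subst hj; rw [Pi.single_eq_same]; exact AddSubgroup.mem_iSup_of_mem m hx
      · rw [Pi.single_eq_of_ne hj, ZeroMemClass.coe_zero]; exact zero_mem _
    have hmemE : jAway S κ ρ v m k (thetaLayerKummer S ρ k W (Θ v hv) κ v (hΘ v hv) m (Pi.single i x₀ : Fin r → ↥(localLayerPointsOfEmb κ (closureEmb (K := ℚ) (v.adicCompletion ℚ)) W m))) ∈ Eplus :=
      ⟨ψ, R, k, hψ, hRpl, hK⟩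
    have hval := hc₂ t _ ψ R k hRT hψ hK
    rw [ht _ hmemE] at hval
    have hid : (fun j ↦ (⟨(2 ^ k) • R j, hRT j⟩ : ↥(localTowerPointsOfEmb κ (closureEmb (K := ℚ) (v.adicCompletion ℚ)) W))) = (Pi.single i x₁ : Fin r → ↥(localTowerPointsOfEmb κ (closureEmb (K := ℚ) (v.adicCompletion ℚ)) W)) := by
      funext j
      apply Subtype.ext
      change (2 ^ k) • R j = (((Pi.single i x₁ : Fin r → ↥(localTowerPointsOfEmb κ (closureEmb (K := ℚ) (v.adicCompletion ℚ)) W)) j : ↥(localTowerPointsOfEmb κ (closureEmb (K := ℚ) (v.adicCompletion ℚ)) W)) :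
        localPoints W (v.adicCompletion ℚ))
      rw [hR j]
      by_cases hj : j = i
      · subst hj; rw [Pi.single_eq_same, Pi.single_eq_same]
      · rw [Pi.single_eq_of_ne hj, Pi.single_eq_of_ne hj, ZeroMemClass.coe_zero, ZeroMemClass.coe_zero]
    rw [hid] at hval
    haveI : NeZero (2 ^ k) := ⟨pow_ne_zero k two_ne_zero⟩
    have hdvd := pow_dvd_of_nsmul_inv_pow_eq_zero hval.symm
    have hlt := ZMod.val_lt (PadicInt.toZModPow k (t (Pi.single i x₁ : Fin r → ↥(localTowerPointsOfEmb κ (closureEmb (K := ℚ) (v.adicCompletion ℚ)) W))))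
    exact (ZMod.val_eq_zero _).mp (Nat.eq_zero_of_dvd_of_lt hdvd hlt)

end Plus

end Summit.BirchSwinnertonDyer.BirchSwinnertonDyer.Theorems.ThetaTransport.AtTwoPackage

end
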